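import Summits.BirchSwinnertonDyer.BirchSwinnertonDyer.Theorems.SchneiderFreeAdditiveX3GoodMemberLine
import Summits.BirchSwinnertonDyer.BirchSwinnertonDyer.Theorems.SchneiderFreeAdditiveX3GordTwoBranchIMCCaseOne
import Summits.BirchSwinnertonDyer.Rank1Residual.Additive.GordIsogenyInvarianceClasses
import Literature.NumberTheory.EllipticCurves.IsogenyConductorProofs
import Literature.NumberTheory.EllipticCurves.IsogenyDualElliptic
import HarnessLib

/-!
# Route `SchneiderFreeAdditiveX3` (K1 door), crux `GordTwoBranchIMC` (stmt-BirchSwinnertonDyer-19177),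
# layer 2 (KY-reading): the antecedent F-W «GoodMember(∀)» is a THEOREM — every curve of the
# (G-ord, `e = 2`) cell has, for every quadratic `K` unramified at `p`, a `p`-power-isogenous globally
# minimal member `W₁` in Keller–Yin's normalisation: `W₁(K)[p] = 0`, a rational `p`-line NOT fixed by
# the decomposition groups at `p`, Case (I), `E[p]` reducible, `N_{W₁} = N` (granted Ogg–Saito)

Cell `bsd-schneider-ideate` (HOME `run/shared/lean/pub/bsd-schneider-ideate/`), seat `door-c4` gen 7;
file 3 of 3 (files 1–2: `SchneiderFreeAdditiveX3GoodMemberNonsplit.lean`, `…GoodMemberLine.lean`).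
PARTITION: board row B6 ∩ X3 ∩ sst-twist, r = 1, (G-ord, `e = 2`) cell (2 560 pairs);
types-the-object-of the hypothesis «GoodMember(∀)» (binders `W₁, φ, hdeg, hd, hN₁, hcase₁, hred₁,
hlat₁, htf₁` of door-c3 g7's `xac_charIdeal_map_le_of_KY_OPEN`, p472079; memo
`KY24b-anatomy-P2-g12.md` §4 "K-W"); closes nothing. HONEST FRAMING: the only non-elementary input is
the NAMED FACT Ogg–Saito (`WeierstrassCurve.artinConductorExponent_tate_eq_conductorExponent_of_isElliptic`,
Silverman *ATAEC* IV.10.2 / IV.11.1), for the one clause `N_{W₁} = N`, exactly as in the tree's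
`conductorNorm_eq_of_isIsogenous_of_tate`; everything else is fact-free; BSD is not advanced; THEOREMS
ONLY (no definition, no named fact, no `sorry`).

## What is proved

* `exists_goodMember` — on the cell (`ClassX3 W p`, `SubGordTwo W p`, `p ≠ 2`), for `[K : ℚ] = 2` with
  `p ∤ d_K`: there are a globally minimal elliptic `W₁`, a `ℚ`-isogeny `φ : W₁ → W` of degree
  `p^m · 1` (the dual of file 2's `g : W → W₁`, `φ ∘ g = [p^k]`, Silverman *AEC* III.6.1), with
  `N_{W₁} = N_W` (granted Ogg–Saito), Case (I) for `W₁` (door-c3 g7's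
  `hasGoodOrdinaryReductionOverQuadraticAt_of_subGordTwo` on `W₁`, the cell predicates being isogeny
  invariants — bsd-addord's `subGord_iff_of_isIsogenous`, `semistabilityIndex_eq_of_isIsogenous_of_typeG_of_addv`,
  `Addv.of_isIsogenous_of_typeG`), `Red W₁ p`, a rational `p`-line `Φ ≤ W₁[p]` with
  `¬ LineDecompositionTrivialAt W₁ p Φ`, and `W₁(K)[p] = 0` — verbatim the good-member binders of
  p472079.
* `exists_goodMember_of_heegner` — the same on the door's data: `K` imaginary quadratic with the
  Heegner hypothesis for `N` and `p ∣ N`, so `p ∤ d_K` (tree `SatisfiesHeegnerHypothesis.not_dvd_discr`).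

References: T. Keller, M. Yin, arXiv:2410.23241 §3.1 and Assumption 2.0.3 [KellerYin2024PotOrd];
J. H. Silverman, *AEC* 2nd ed. III.6.1, *ATAEC* Exercise 4.40, IV.10.2, IV.11.1
[SilvermanAEC2009, SilvermanATAEC1994]; HOME/memos/KY24b-anatomy-P2-g12.md §4 (K-W).
-/

set_option linter.dupNamespace false
set_option autoImplicit false

noncomputable section

open scoped Classical NumberField

open WeierstrassCurve NumberField IsDedekindDomain Literature.NumberTheory.EllipticCurves
  Literature.NumberTheory.EllipticCurves.Rank1Residual
  Literature.NumberTheory.GaloisRepresentations Field Rat.HeightOneSpectrum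
  Literature.NumberTheory.EllipticCurves.KellerYin2024
  Literature.NumberTheory.QuadraticFields
  Summit.BirchSwinnertonDyer.Rank1Residual.X1.StableCyclicQuotient
  Summit.BirchSwinnertonDyer.Rank1Residual
  Summit.BirchSwinnertonDyer.Rank1Residual.Additive

namespace Summit.BirchSwinnertonDyer.BirchSwinnertonDyer.Theorems.SchneiderFree.GoodMember

variable {p : ℕ} [hp : Fact p.Prime]

/-! ## §3 The good member on the door's (G-ord, `e = 2`) cell -/

section Door

/-- **K-W: the good member exists (granted Ogg–Saito for `N_{W₁} = N`).** Let `W/ℚ` be globally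
minimal on the cell — `ClassX3 W p` (`E[p]` reducible, `p` additive), `SubGordTwo W p` ((G-ord),
`e = 2`), `p` odd — and `K` a quadratic field with `p ∤ d_K`. Then there are a globally minimal
elliptic `W₁/ℚ` and a `ℚ`-isogeny `φ : W₁ → W` of degree `p^m · 1` with: `N_{W₁} = N_W`
(`conductorNorm_eq_of_isIsogenous_of_tate`, granted the Ogg–Saito schema `hOS`), Case (I) for `W₁`
(`hasGoodOrdinaryReductionOverQuadraticAt_of_subGordTwo` on `W₁`; the cell predicates transported by
`subGord_iff_of_isIsogenous`, `semistabilityIndex_eq_of_isIsogenous_of_typeG_of_addv`,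
`Addv.of_isIsogenous_of_typeG`), `Red W₁ p`, a rational `p`-line `Φ ≤ W₁[p]` with
`¬ LineDecompositionTrivialAt W₁ p Φ` (Keller–Yin's lattice normalisation `φ|_{G_p} ≠ 𝟙`), and
`W₁(K)[p] = 0` — the binders of the good member in door-c3 g7's `xac_charIdeal_map_le_of_KY_OPEN`
(p472079). `φ` is the dual of `g : W → W₁` of §1 (`φ ∘ g = [p^k]`, Silverman *AEC* III.6.1).
[cite: KellerYin2024PotOrd, §3.1 (Case (I); φ|G_p ≠ 1; E(K)[p] = 0), arXiv:2410.23241 pp. 13–17]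
[cite: SilvermanATAEC1994, Exercise 4.40 (PDF p. 380) with §IV.10 (PDF p. 364) and Thm. IV.11.1]
[cite: SilvermanAEC2009, Thm. III.6.1(a), Prop. III.4.12, Cor. IX.6.2, X.5 Cor. 5.4] -/
theorem exists_goodMember
    (hOS : ∀ (W : WeierstrassCurve ℚ) (ℓ : ℕ) [Fact ℓ.Prime],
      W.artinConductorExponent_tate_eq_conductorExponent_of_isElliptic ℓ)
    (hp2 : p ≠ 2) (W : WeierstrassCurve ℚ) [W.IsElliptic] [W.IsGloballyMinimal]
    (hX : ClassX3 W p) (hS : SubGordTwo W p)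
    (K : Type) [Field K] [NumberField K] (h2K : Module.finrank ℚ K = 2)
    (hpd : ¬ (p : ℤ) ∣ NumberField.discr K) :
    ∃ (W₁ : WeierstrassCurve ℚ) (_ : W₁.IsElliptic) (_ : W₁.IsGloballyMinimal) (φ : Isogeny W₁ W) (m : ℕ),
      φ.degree = p ^ m * 1 ∧ ¬ p ∣ 1 ∧ W₁.conductorNorm ℤ = W.conductorNorm ℤ ∧
      W₁.HasGoodOrdinaryReductionOverQuadraticAt p ∧ Red W₁ p ∧
      (∃ Φ : AddSubgroup (geomTorsion W₁ (p : ℤ)),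
        IsRationalLine W₁ p Φ ∧ ¬ LineDecompositionTrivialAt W₁ p Φ) ∧
      ∀ Q : (W₁.baseChange K).toAffine.Point, p • Q = 0 → Q = 0 := by
  have hp' : p.Prime := hp.out
  obtain ⟨Φ₀, hΦ₀⟩ := exists_isRationalLine_of_not_irr (W := W) (p := p) hX.1
  obtain ⟨W₁, hW₁, hW₁min, g, k, L, hdeg, hL, huniq, hn1, hn2, hn3⟩ :=
    exists_member_uniqueLine (V := W) hp2 hΦ₀ hpd
  haveI := hW₁
  haveI := hW₁min
  -- the dual isogeny `φ : W₁ → W`, `φ ∘ g = [p^k]`, has degree `p^k`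
  obtain ⟨φ, hφ⟩ := g.exists_dual_of_isElliptic
  have hφdeg : φ.degree = p ^ k := by
    have h1 : Nat.card (φ.comp g).toAddMonoidHom.ker = Nat.card φ.toAddMonoidHom.ker * g.degree :=
      AddMonoidHom.natCard_ker_comp_of_surjective φ.toAddMonoidHom g.toAddMonoidHom g.surjective
    have hker : (φ.comp g).toAddMonoidHom.ker = geomTorsion W ((p ^ k : ℕ) : ℤ) := by
      ext P
      rw [AddMonoidHom.mem_ker, Isogeny.coe_toAddMonoidHom, Isogeny.comp_apply, hφ, hdeg]
      exact (Submodule.mem_torsionBy_iff _ _).symm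
    have hpk : ((p ^ k : ℕ) : ℚ) ≠ 0 := by exact_mod_cast pow_ne_zero k hp'.ne_zero
    rw [hker, natCard_geomTorsion_eq_sq W hpk, hdeg, sq] at h1
    unfold Isogeny.degree
    exact (Nat.eq_of_mul_eq_mul_right (pow_pos hp'.pos k) h1).symm
  have hiso : IsIsogenous W W₁ := ⟨g⟩
  have hiso' : IsIsogenous W₁ W := ⟨φ⟩
  -- the cell predicates for `W₁`
  have hG : TypeG W p := (subGord_iff_typeG_of_addv W p hp2 hX.2).mp hS.1
  have hadd₁ : Addv W₁ p := Addv.of_isIsogenous_of_typeG hX.2 hG hiso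
  have hSG₁ : SubGord W₁ p := (subGord_iff_of_isIsogenous hp2 hX.2 hiso).mp hS.1
  have he₁ : semistabilityIndex W₁ p = 2 :=
    (semistabilityIndex_eq_of_isIsogenous_of_typeG_of_addv hp2 hX.2 hG hiso).trans hS.2
  have hred₁ : Red W₁ p := red_of_isRationalLine hL
  have hcase₁ : W₁.HasGoodOrdinaryReductionOverQuadraticAt p :=
    hasGoodOrdinaryReductionOverQuadraticAt_of_subGordTwo hp2 W₁ ⟨hred₁, hadd₁⟩ ⟨hSG₁, he₁⟩
  refine ⟨W₁, hW₁, hW₁min, φ, k, by rw [hφdeg, mul_one], hp'.not_dvd_one,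
    conductorNorm_eq_of_isIsogenous_of_tate hOS W₁ W hiso', hcase₁, hred₁, ⟨L, hL, hn3⟩,
    fun Q hQ ↦ forall_baseChange_nsmul_eq_zero hp2 huniq hn1 h2K hpd hn2 Q hQ⟩

/-- **K-W on the door's data.** As `exists_goodMember`, with `p ∤ d_K` READ OFF the door's Heegner
datum: `K` imaginary quadratic satisfying the Heegner hypothesis for `N = N_W`, and `p ∣ N` (`p` is
additive for `W`), so `p` splits in `K` and `p ∤ d_K` (tree `SatisfiesHeegnerHypothesis.not_dvd_discr`).
[cite: KellerYin2024PotOrd, §3.1 and Assumption 2.0.3 (p = v v̄ split in K)] -/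
theorem exists_goodMember_of_heegner
    (hOS : ∀ (W : WeierstrassCurve ℚ) (ℓ : ℕ) [Fact ℓ.Prime],
      W.artinConductorExponent_tate_eq_conductorExponent_of_isElliptic ℓ)
    (hp2 : p ≠ 2) (W : WeierstrassCurve ℚ) [W.IsElliptic] [W.IsGloballyMinimal]
    (hX : ClassX3 W p) (hS : SubGordTwo W p) {N : ℕ} (hpN : p ∣ N)
    (K : Type) [Field K] [NumberField K] (hK : IsImaginaryQuadratic K)
    (hHe : SatisfiesHeegnerHypothesis N K) :
    ∃ (W₁ : WeierstrassCurve ℚ) (_ : W₁.IsElliptic) (_ : W₁.IsGloballyMinimal) (φ : Isogeny W₁ W) (m : ℕ),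
      φ.degree = p ^ m * 1 ∧ ¬ p ∣ 1 ∧ W₁.conductorNorm ℤ = W.conductorNorm ℤ ∧
      W₁.HasGoodOrdinaryReductionOverQuadraticAt p ∧ Red W₁ p ∧
      (∃ Φ : AddSubgroup (geomTorsion W₁ (p : ℤ)),
        IsRationalLine W₁ p Φ ∧ ¬ LineDecompositionTrivialAt W₁ p Φ) ∧
      ∀ Q : (W₁.baseChange K).toAffine.Point, p • Q = 0 → Q = 0 :=
  exists_goodMember hOS hp2 W hX hS K hK.1
    (Literature.SatisfiesHeegnerHypothesis.not_dvd_discr hK.1 hHe hp.out hpN)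

end Door

end Summit.BirchSwinnertonDyer.BirchSwinnertonDyer.Theorems.SchneiderFree.GoodMember

end
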